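import Mathlib
import Summits.ValiantsHypothesis.ValiantsHypothesis.Theorems.BarrierLeverPartitionMinorsHitByVPHiddenStatesBlockCut

/-!
# Route BarrierLever — item `PartitionMinorsHitByVP` (stmt-ValiantsHypothesis-19717), line `hidden_states`:
# THE LAPLACE EXPANSION OF A JOIN OVER ROW LABELLINGS — «good ⇒ union» (necessary) and «private class ⇒ good» (sufficient)

Helper file (`--supports stmt-ValiantsHypothesis-19717`; cell valiant-natproofs, rung V4, 𝒟-side door (c), line `hidden_states`,
node #1 `stub_universalJoinWide`; prover seat val-np-p3 gen 21; memo HOME/val-np-p3/g21/MEMO-bpwindow-valnp3-g21.md §4–§6).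
Definition-light (bookkeeping `def`s only). Closes NO item.

THE POINT (memo §5). With the per-piece uniformity architecture dead beyond star range (p723198), the invariant that survives
the censuses is JOINT: for a join `X = [X₁ | … | X_m]` of pieces (columns labelled by pieces, `colLab`), group the Leibniz
expansion of `det X` by the ROW LABELLING `L : rows → pieces` it induces:

  `det X = Σ_L det (blockZeroL X L colLab)`                                   (`det_eq_sum_blockZeroL`)

where `blockZeroL` keeps the entry `(i,k)` iff `L i = colLab k`, and `det (blockZeroL X L colLab) ≠ 0` iff every block
`{L = p} × {colLab = p}` is a BASE (`GreedyCut.IsBase`: square, independent rows) (`det_blockZeroL_ne_zero_iff`). Hence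
* **good ⇒ union** (`exists_isBase_of_det_ne_zero`, `exists_basePartition_of_good`): a nonsingular join admits a partition of
  its rows into per-piece bases — the MATROID-UNION condition; contrapositively every design whose pieces cannot jointly cover a
  row family (Σ_p rank_p(Y) < |Y|) is singular on it FOR EVERY TABLE (the common form of all counting no-gos of the line).
* **private class ⇒ good** (`exists_scale_det_ne_zero`, `join_good_of_private_basePartition`): scaling piece `p`'s table by
  `c^{λ_p ω_a}` in coordinate `a` multiplies the term of `L` by `c^{Σ_i λ_{L i} ω(u i)}` (`det_scaleL_eq_sum`, `joinMat_scaleTab`);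
  if ONE labelling `L₀` is a base-partition and every other labelling with the same exponent has a non-base block, the
  coefficient of that power of `c` is `det (blockZeroL X L₀) ≠ 0`, so some scaled table is good. This is the multi-piece form
  of the greedy cut (`GreedyCut.exists_rowScale_det_ne_zero_of_bases` = one block + lightest base) and of row-threshold
  absorption (`SimplexJoin.good_of_absorb`); with `λ_p = B^p`, `B > Σ_i ω(u i)`, «same exponent» = «same weight in every piece».
CENSUS (kit j331996, j332171, j332196; memo §4): in ≈ 1.6·10⁷ instances of pair-ball / 3-ball joins (h = 4–12, exhaustive at
h ≤ 5), good ⟺ union WITHOUT exception (0 cancellations), and a private weighted class exists in all but a few symmetric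
families (e.g. the six 2-subsets of `Fin 4` for two pair blocks on 2 states: 12 base-partitions in 6 classes of 2 — good anyway).
WHAT THIS IS NOT: «union ⇒ good» in general is OPEN (conjecture U⇒G of the memo); nothing here asserts it; item 19717 stays
OPEN; nothing on crux 14610 or VP ≠ VNP.
-/

set_option linter.dupNamespace false

namespace Summit.ValiantsHypothesis.ValiantsHypothesis.Theorems.BarrierLever.HiddenStates

open Finset Matrix

noncomputable section

namespace JoinLaplace

open GreedyCut

variable {r m : ℕ}

/-! ## 1. Labelled block-zeroing and piece-dependent row scaling -/

/-- Keep the entry `(i, k)` iff the row label of `i` equals the column label of `k`. -/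
def blockZeroL (N : Matrix (Fin r) (Fin r) ℂ) (L colLab : Fin r → Fin m) : Matrix (Fin r) (Fin r) ℂ :=
  Matrix.of fun i k : Fin r => if L i = colLab k then N i k else 0

/-- Scale the entry `(i, k)` by `c ^ ex (colLab k) i` (piece-dependent row scaling). -/
def scaleL (N : Matrix (Fin r) (Fin r) ℂ) (colLab : Fin r → Fin m) (ex : Fin m → Fin r → ℕ) (c : ℂ) :
    Matrix (Fin r) (Fin r) ℂ :=
  Matrix.of fun i k : Fin r => c ^ ex (colLab k) i * N i k

/-- The exponent of a row labelling. -/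
def expo (ex : Fin m → Fin r → ℕ) (L : Fin r → Fin m) : ℕ := ∑ i, ex (L i) i

/-- The rows (or columns) carrying the label `p`. -/
def fiber (L : Fin r → Fin m) (p : Fin m) : Finset (Fin r) := Finset.univ.filter fun i => L i = p

/-- Membership in a fiber. -/
@[simp] theorem mem_fiber {L : Fin r → Fin m} {p : Fin m} {i : Fin r} : i ∈ fiber L p ↔ L i = p := by
  simp [fiber]

/-! ## 2. The Laplace expansion over row labellings -/

/-- **`det (scaleL N) = Σ_L c^{expo L} · det (blockZeroL N L)`.** -/
theorem det_scaleL_eq_sum (N : Matrix (Fin r) (Fin r) ℂ) (colLab : Fin r → Fin m) (ex : Fin m → Fin r → ℕ) (c : ℂ) :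
    (scaleL N colLab ex c).det = ∑ L : Fin r → Fin m, c ^ expo ex L * (blockZeroL N L colLab).det := by
  classical
  simp only [Matrix.det_apply', scaleL, blockZeroL, Matrix.of_apply, Finset.mul_sum]
  rw [Finset.sum_comm]
  refine Finset.sum_congr rfl fun σ _ => ?_
  -- the only labelling compatible with `σ`
  set L₀ : Fin r → Fin m := fun i => colLab (σ.symm i) with hL₀
  rw [Finset.sum_eq_single L₀]
  · have hprod : ∏ k, (if L₀ (σ k) = colLab k then N (σ k) k else 0) = ∏ k, N (σ k) k :=
      Finset.prod_congr rfl fun k _ => by rw [if_pos (by simp [hL₀])]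
    have hexp : c ^ expo ex L₀ = ∏ k, c ^ ex (colLab k) (σ k) := by
      rw [Finset.prod_pow_eq_pow_sum, expo]
      congr 1
      rw [← Equiv.sum_comp σ (fun i => ex (L₀ i) i)]
      exact Finset.sum_congr rfl fun k _ => by simp [hL₀]
    rw [hprod, hexp, Finset.prod_mul_distrib]
    ring
  · intro L _ hL
    obtain ⟨i, hi⟩ : ∃ i, L i ≠ L₀ i := by
      by_contra hall
      push Not at hall
      exact hL (funext hall)
    have hzero : ∏ k, (if L (σ k) = colLab k then N (σ k) k else 0) = 0 := by
      refine Finset.prod_eq_zero (Finset.mem_univ (σ.symm i)) ?_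
      rw [if_neg]
      simpa [hL₀] using hi
    rw [hzero]; ring
  · intro h; exact absurd (Finset.mem_univ _) h

/-- **`det N = Σ_L det (blockZeroL N L)`** (the Laplace expansion of a join over row labellings). -/
theorem det_eq_sum_blockZeroL (N : Matrix (Fin r) (Fin r) ℂ) (colLab : Fin r → Fin m) :
    N.det = ∑ L : Fin r → Fin m, (blockZeroL N L colLab).det := by
  have h := det_scaleL_eq_sum N colLab (fun _ _ => 0) 1
  have hN : scaleL N colLab (fun _ _ => 0) 1 = N := by
    ext i k; simp [scaleL]
  simpa [hN, expo] using h

/-- **PRIVATE CLASS ⇒ SOME SCALING IS NONSINGULAR.** If `L₀` has `det (blockZeroL N L₀) ≠ 0` and every other labelling with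
the same exponent has `det (blockZeroL N L) = 0`, then `det (scaleL N colLab ex c) ≠ 0` for some `c`. -/
theorem exists_scale_det_ne_zero (N : Matrix (Fin r) (Fin r) ℂ) (colLab : Fin r → Fin m) (ex : Fin m → Fin r → ℕ)
    (L₀ : Fin r → Fin m) (h0 : (blockZeroL N L₀ colLab).det ≠ 0)
    (hpriv : ∀ L, expo ex L = expo ex L₀ → L ≠ L₀ → (blockZeroL N L colLab).det = 0) :
    ∃ c : ℂ, (scaleL N colLab ex c).det ≠ 0 := by
  classical
  set p : Polynomial ℂ :=
    ∑ L : Fin r → Fin m, Polynomial.C ((blockZeroL N L colLab).det) * Polynomial.X ^ expo ex L with hp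
  have hcoeff : p.coeff (expo ex L₀) = (blockZeroL N L₀ colLab).det := by
    rw [hp, Polynomial.finsetSum_coeff]
    simp only [Polynomial.coeff_C_mul_X_pow]
    rw [Finset.sum_eq_single L₀]
    · rw [if_pos rfl]
    · intro L _ hL
      by_cases he : expo ex L₀ = expo ex L
      · rw [if_pos he]; exact hpriv L he.symm hL
      · rw [if_neg he]
    · intro h; exact absurd (Finset.mem_univ _) h
  have hpne : p ≠ 0 := fun h => h0 (by rw [← hcoeff, h, Polynomial.coeff_zero])
  have heval : ∀ c, p.eval c = (scaleL N colLab ex c).det := by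
    intro c
    rw [det_scaleL_eq_sum, hp, Polynomial.eval_finsetSum]
    refine Finset.sum_congr rfl fun L _ => ?_
    rw [Polynomial.eval_mul, Polynomial.eval_C, Polynomial.eval_pow, Polynomial.eval_X, mul_comm]
  by_contra hall
  push Not at hall
  apply hpne
  refine Polynomial.funext fun c => ?_
  rw [heval, Polynomial.eval_zero]
  exact hall c

/-! ## 3. `det (blockZeroL N L) ≠ 0` iff every block is a base -/

/-- If every block `{L = p} × {colLab = p}` is a base, `blockZeroL N L colLab` is nonsingular. -/
theorem det_blockZeroL_ne_zero_of_isBase (N : Matrix (Fin r) (Fin r) ℂ) (L colLab : Fin r → Fin m)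
    (hB : ∀ p, IsBase N (fiber colLab p) (fiber L p)) : (blockZeroL N L colLab).det ≠ 0 := by
  classical
  intro hdet
  obtain ⟨v, hv0, hv⟩ := Matrix.exists_vecMul_eq_zero_iff.mpr hdet
  apply hv0
  funext i
  -- restrict the relation to the block of `p = L i`
  set p := L i with hp
  have hli := (hB p).2
  -- the relation Σ_{i' : L i' = p} v i' • rowVec N (fiber colLab p) i' = 0
  have hrel : ∑ i' ∈ fiber L p, v i' • rowVec N (fiber colLab p) i' = 0 := by
    funext k
    have hk := congrFun hv k.1
    simp only [Matrix.vecMul, dotProduct, Pi.zero_apply, blockZeroL, Matrix.of_apply] at hk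
    simp only [Finset.sum_apply, Pi.smul_apply, smul_eq_mul, rowVec, Pi.zero_apply]
    rw [← hk]
    rw [← Finset.sum_filter_add_sum_filter_not Finset.univ (fun i' => L i' = p)]
    have hk2 : colLab k.1 = p := mem_fiber.mp k.2
    have h2 : ∑ i' ∈ Finset.univ.filter (fun i' => ¬ L i' = p), v i' * (if L i' = colLab k.1 then N i' k.1 else 0) = 0 :=
      Finset.sum_eq_zero fun i' hi' => by
        rw [Finset.mem_filter] at hi'
        rw [if_neg (by rw [hk2]; exact hi'.2), mul_zero]
    rw [h2, add_zero]
    refine Finset.sum_congr rfl fun i' hi' => ?_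
    simp only [Finset.mem_filter, Finset.mem_univ, true_and] at hi'
    rw [if_pos (by rw [hi', hk2])]
  -- independence of the block's rows
  have hli' : LinearIndependent ℂ (fun x : ↥(fiber L p) => rowVec N (fiber colLab p) x) := hli
  have := Fintype.linearIndependent_iff.mp hli' (fun x => v x.1) (by
    rw [← hrel]
    exact Finset.sum_coe_sort (fiber L p) (fun i' => v i' • rowVec N (fiber colLab p) i'))
  exact this ⟨i, mem_fiber.mpr rfl⟩

/-- Conversely, a nonsingular `blockZeroL N L colLab` has every block a base. -/
theorem isBase_of_det_blockZeroL_ne_zero (N : Matrix (Fin r) (Fin r) ℂ) (L colLab : Fin r → Fin m)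
    (hdet : (blockZeroL N L colLab).det ≠ 0) (p : Fin m) : IsBase N (fiber colLab p) (fiber L p) := by
  classical
  -- rows of the block-zeroed matrix are independent
  have hunit : IsUnit (blockZeroL N L colLab) :=
    (Matrix.isUnit_iff_isUnit_det _).mpr (isUnit_iff_ne_zero.mpr hdet)
  have hrows : LinearIndependent ℂ (fun i => blockZeroL N L colLab i) := Matrix.linearIndependent_rows_of_isUnit hunit
  -- independence of each block
  have hind : ∀ p', LinearIndepOn ℂ (rowVec N (fiber colLab p')) (fiber L p' : Set (Fin r)) := by
    intro p'
    show LinearIndependent ℂ (fun x : ↥(fiber L p') => rowVec N (fiber colLab p') x)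
    rw [Fintype.linearIndependent_iff]
    intro g hg x
    -- extend `g` by zero and test against the rows of `blockZeroL`
    set G : Fin r → ℂ := fun i => if hi : L i = p' then g ⟨i, mem_fiber.mpr hi⟩ else 0 with hG
    have hGfib : ∀ y : ↥(fiber L p'), G y.1 = g y := fun y => by
      have hy : L y.1 = p' := mem_fiber.mp y.2
      simp [hG, hy]
    have hGrel : ∑ i, G i • blockZeroL N L colLab i = 0 := by
      funext k
      simp only [Finset.sum_apply, Pi.smul_apply, smul_eq_mul, Pi.zero_apply, blockZeroL, Matrix.of_apply]
      by_cases hk : colLab k = p'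
      · have hgk := congrFun hg ⟨k, mem_fiber.mpr hk⟩
        simp only [Finset.sum_apply, Pi.smul_apply, smul_eq_mul, rowVec, Pi.zero_apply] at hgk
        calc ∑ i, G i * (if L i = colLab k then N i k else 0)
            = ∑ i ∈ fiber L p', G i * (if L i = colLab k then N i k else 0) := by
              symm
              refine Finset.sum_subset (Finset.subset_univ _) fun i _ hi => ?_
              have hi' : ¬ L i = p' := fun h => hi (mem_fiber.mpr h)
              simp [hG, hi']
          _ = ∑ i ∈ fiber L p', G i * N i k :=
              Finset.sum_congr rfl fun i hi => by
                rw [if_pos (by rw [mem_fiber.mp hi, hk])]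
          _ = ∑ y : ↥(fiber L p'), G y.1 * N y.1 k := (Finset.sum_coe_sort (fiber L p') _).symm
          _ = ∑ y : ↥(fiber L p'), g y * N y.1 k := Fintype.sum_congr _ _ fun y => by rw [hGfib]
          _ = 0 := hgk
      · refine Finset.sum_eq_zero fun i _ => ?_
        by_cases hi : L i = p'
        · rw [if_neg (by rw [hi]; exact Ne.symm hk), mul_zero]
        · simp [hG, hi]
    have hG0 := Fintype.linearIndependent_iff.mp hrows G hGrel x.1
    rw [← hGfib]
    exact hG0
  -- cardinalities: `|fiber L p'| ≤ |fiber colLab p'|` for all `p'`, and the totals agree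
  have hle : ∀ p', (fiber L p').card ≤ (fiber colLab p').card := by
    intro p'
    have h := (hind p').fintype_card_le_finrank
    simp only [Finset.coe_sort_coe, Fintype.card_coe, Module.finrank_fintype_fun_eq_card] at h
    exact h
  have htot : ∑ p', (fiber L p').card = ∑ p', (fiber colLab p').card := by
    have h1 : ∀ f : Fin r → Fin m, ∑ p', (fiber f p').card = (Finset.univ : Finset (Fin r)).card := fun f => by
      simp only [fiber]
      exact (Finset.card_eq_sum_card_fiberwise (f := f) (s := Finset.univ) (t := Finset.univ)
        (fun x _ => Finset.mem_univ (f x))).symm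
    rw [h1, h1]
  have heq : ∀ p', (fiber L p').card = (fiber colLab p').card := by
    by_contra hne
    push Not at hne
    obtain ⟨p', hp'⟩ := hne
    have hlt : (fiber L p').card < (fiber colLab p').card := lt_of_le_of_ne (hle p') hp'
    have : ∑ p', (fiber L p').card < ∑ p', (fiber colLab p').card :=
      Finset.sum_lt_sum (fun q _ => hle q) ⟨p', Finset.mem_univ _, hlt⟩
    omega
  exact ⟨heq p, hind p⟩

/-- `det (blockZeroL N L colLab) ≠ 0` iff every block is a base. -/
theorem det_blockZeroL_ne_zero_iff (N : Matrix (Fin r) (Fin r) ℂ) (L colLab : Fin r → Fin m) :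
    (blockZeroL N L colLab).det ≠ 0 ↔ ∀ p, IsBase N (fiber colLab p) (fiber L p) :=
  ⟨isBase_of_det_blockZeroL_ne_zero N L colLab, det_blockZeroL_ne_zero_of_isBase N L colLab⟩

/-- **GOOD ⇒ UNION.** A nonsingular join admits a labelling of its rows by pieces all of whose blocks are bases. -/
theorem exists_isBase_of_det_ne_zero (N : Matrix (Fin r) (Fin r) ℂ) (colLab : Fin r → Fin m) (hdet : N.det ≠ 0) :
    ∃ L : Fin r → Fin m, ∀ p, IsBase N (fiber colLab p) (fiber L p) := by
  rw [det_eq_sum_blockZeroL N colLab] at hdet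
  obtain ⟨L, -, hL⟩ := Finset.exists_ne_zero_of_sum_ne_zero hdet
  exact ⟨L, isBase_of_det_blockZeroL_ne_zero N L colLab hL⟩

/-! ## 4. The join matrix of node #1: tables realise the scalings -/

variable {h K : ℕ}

/-- The `u`-side block-additive matrix of a join design `e : Fin r → Fin m × Finset (Fin K)` (as in `Stmt.stub_universalJoinWide`):
entry `(i, k) = ∏_{a ∈ u i} (tx (e k).1 none a + Σ_{q ∈ (e k).2} tx (e k).1 (some q) a)`. -/
def joinMat (u : Fin r → Finset (Fin h)) (e : Fin r → Fin m × Finset (Fin K)) (tx : Fin m → Option (Fin K) → Fin h → ℂ) :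
    Matrix (Fin r) (Fin r) ℂ :=
  Matrix.of fun i k : Fin r => ∏ a ∈ u i, (tx (e k).1 none a + ∑ q ∈ (e k).2, tx (e k).1 (some q) a)

/-- The column labelling of a design: the piece of each column. -/
def pieceOf (e : Fin r → Fin m × Finset (Fin K)) : Fin r → Fin m := fun k => (e k).1

/-- Scaling piece `p`'s table (base point and states alike) by `c ^ (lam p * ω a)` in coordinate `a`. -/
def scaleTab (lam : Fin m → ℕ) (ω : Fin h → ℕ) (c : ℂ) (tx : Fin m → Option (Fin K) → Fin h → ℂ) :
    Fin m → Option (Fin K) → Fin h → ℂ :=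
  fun p o a => c ^ (lam p * ω a) * tx p o a

/-- **Tables realise the piece-dependent row scaling**: the join matrix of the scaled table is `scaleL` of the join matrix
with exponents `ex p i = lam p · Σ_{a ∈ u i} ω a`. -/
theorem joinMat_scaleTab (u : Fin r → Finset (Fin h)) (e : Fin r → Fin m × Finset (Fin K))
    (tx : Fin m → Option (Fin K) → Fin h → ℂ) (lam : Fin m → ℕ) (ω : Fin h → ℕ) (c : ℂ) :
    joinMat u e (scaleTab lam ω c tx) = scaleL (joinMat u e tx) (pieceOf e) (fun p i => lam p * ∑ a ∈ u i, ω a) c := by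
  ext i k
  simp only [joinMat, scaleTab, scaleL, pieceOf, Matrix.of_apply]
  have hfac : ∀ a, c ^ (lam (e k).1 * ω a) * tx (e k).1 none a + ∑ q ∈ (e k).2, c ^ (lam (e k).1 * ω a) * tx (e k).1 (some q) a =
      c ^ (lam (e k).1 * ω a) * (tx (e k).1 none a + ∑ q ∈ (e k).2, tx (e k).1 (some q) a) := by
    intro a
    rw [mul_add, Finset.mul_sum]
  rw [Finset.prod_congr rfl fun a _ => hfac a, Finset.prod_mul_distrib, Finset.prod_pow_eq_pow_sum, Finset.mul_sum]

/-- `IsBase` for the block of piece `p` only reads piece `p`'s table. -/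
theorem isBase_joinMat_of_eq (u : Fin r → Finset (Fin h)) (e : Fin r → Fin m × Finset (Fin K))
    {tx tx' : Fin m → Option (Fin K) → Fin h → ℂ} {p : Fin m} (hp : tx p = tx' p) {R : Finset (Fin r)}
    (hB : IsBase (joinMat u e tx) (fiber (pieceOf e) p) R) : IsBase (joinMat u e tx') (fiber (pieceOf e) p) R := by
  refine isBase_congr (fun i k hk => ?_) hB
  have hk' : (e k).1 = p := mem_fiber.mp hk
  simp only [joinMat, Matrix.of_apply, hk', hp]

/-- **GOOD ⇒ UNION (base-partition) for joins.** If some table makes the join matrix nonsingular, the rows split into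
per-piece bases (for that table). -/
theorem exists_basePartition_of_good (u : Fin r → Finset (Fin h)) (e : Fin r → Fin m × Finset (Fin K))
    (tx : Fin m → Option (Fin K) → Fin h → ℂ) (hdet : (joinMat u e tx).det ≠ 0) :
    ∃ L : Fin r → Fin m, ∀ p, IsBase (joinMat u e tx) (fiber (pieceOf e) p) (fiber L p) :=
  exists_isBase_of_det_ne_zero _ _ hdet

/-- **NO BASE-PARTITION FOR ANY TABLE ⇒ SINGULAR FOR EVERY TABLE** (the negative engine: e.g. `Σ_p rank_p(Y) < |Y|`). -/
theorem det_joinMat_eq_zero_of_no_basePartition (u : Fin r → Finset (Fin h)) (e : Fin r → Fin m × Finset (Fin K))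
    (hno : ∀ (tx : Fin m → Option (Fin K) → Fin h → ℂ) (L : Fin r → Fin m),
      ∃ p, ¬ IsBase (joinMat u e tx) (fiber (pieceOf e) p) (fiber L p))
    (tx : Fin m → Option (Fin K) → Fin h → ℂ) : (joinMat u e tx).det = 0 := by
  by_contra hdet
  obtain ⟨L, hL⟩ := exists_basePartition_of_good u e tx hdet
  obtain ⟨p, hp⟩ := hno tx L
  exact hp (hL p)

/-- **PRIVATE BASE-PARTITION ⇒ GOOD.** Let `L₀` label the rows by pieces so that every block `{L₀ = p} × {piece p}` is a base
for SOME table of piece `p`, and suppose every other labelling `L` with the same exponent `Σ_i lam (L i) · ω(u i)` has a block that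
is a base for NO table. Then some table makes the whole join matrix nonsingular (multi-piece greedy cut). -/
theorem join_good_of_private_basePartition (u : Fin r → Finset (Fin h)) (e : Fin r → Fin m × Finset (Fin K))
    (lam : Fin m → ℕ) (ω : Fin h → ℕ) (L₀ : Fin r → Fin m)
    (hbase : ∀ p, ∃ t : Fin m → Option (Fin K) → Fin h → ℂ, IsBase (joinMat u e t) (fiber (pieceOf e) p) (fiber L₀ p))
    (hpriv : ∀ L : Fin r → Fin m, L ≠ L₀ →
      ∑ i, lam (L i) * ∑ a ∈ u i, ω a = ∑ i, lam (L₀ i) * ∑ a ∈ u i, ω a →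
      ∃ p, ∀ t : Fin m → Option (Fin K) → Fin h → ℂ, ¬ IsBase (joinMat u e t) (fiber (pieceOf e) p) (fiber L p)) :
    ∃ tx : Fin m → Option (Fin K) → Fin h → ℂ, (joinMat u e tx).det ≠ 0 := by
  classical
  choose t ht using hbase
  -- assemble one table from the per-piece tables
  set tx₀ : Fin m → Option (Fin K) → Fin h → ℂ := fun p => t p p with htx₀
  have h0 : ∀ p, IsBase (joinMat u e tx₀) (fiber (pieceOf e) p) (fiber L₀ p) :=
    fun p => isBase_joinMat_of_eq u e (tx := t p) (tx' := tx₀) rfl (ht p)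
  obtain ⟨c, hc⟩ := exists_scale_det_ne_zero (joinMat u e tx₀) (pieceOf e) (fun p i => lam p * ∑ a ∈ u i, ω a) L₀
    (det_blockZeroL_ne_zero_of_isBase _ _ _ h0) (fun L hexp hL => by
      obtain ⟨p, hp⟩ := hpriv L hL (by simpa [expo] using hexp)
      by_contra hne
      exact hp tx₀ (isBase_of_det_blockZeroL_ne_zero _ _ _ hne p))
  exact ⟨scaleTab lam ω c tx₀, by rwa [joinMat_scaleTab]⟩

end JoinLaplace

end

end Summit.ValiantsHypothesis.ValiantsHypothesis.Theorems.BarrierLever.HiddenStates
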